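import Summits.CriticalPhenomena.PercolationContinuityZ3.Theorems.PercNearOneGluingNoHeavyLowerTailPivotalBHKRow
import HarnessLib

/-!
# `NoHeavyLowerTail` (stmt-CriticalPhenomena-4575) — the pivotal refinement, V: the BHK row for `prodBernoulli` (measure form)

Support file (prover prim-gen-kcluster gen 43; `--supports stmt-CriticalPhenomena-4575`).  No named facts, no sorries, no definitions.
The kernel BHK row `PivotalBHK.bhkRow_PrW` (part II, coordinates `D`, weights `p`) transported to the measure vocabulary used by most
of the tree: for every finite vertex type, all edge weights `w : Sym2 V → [0,1]` and `μ = prodBernoulli w`,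
`μ(a|b|c) · μ(abc ∧ a pivotal) ≤ μ(ac|b) · μ(ab|c)`, where "`a` pivotal" = `b ≁ c` in the configuration with the pairs at `a` deleted
(as in `ThreePointGamma.gamma_pivotal_prodBernoulli`).  [cite: VandenbergHaggstromKahn2005, Thm. 1.4 (p. 7), eq. (2) (p. 2)]
-/

noncomputable section

namespace Summit.CriticalPhenomena.PercolationContinuityZ3.Theorems

namespace PivotalBHK

open Finset Literature.Probability.Percolation Literature.Probability.Percolation.DecisionTree
open Literature.Probability.Percolation.Gladkov ThreePointLB ThreePointGamma
open MeasureTheory Literature.Probability.LatticeModels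
open scoped Classical

variable {V : Type*} [Finite V]

/-- **BHK row, measure form**: `μ(a|b|c) · μ(abc ∧ a pivotal) ≤ μ(ac|b) · μ(ab|c)` for `μ = prodBernoulli w` on any finite vertex type
(`a ≠ b`, `a ≠ c`). [cite: VandenbergHaggstromKahn2005, Thm. 1.4 (p. 7), eq. (2) (p. 2)] -/
theorem bhkRow_prodBernoulli (w : Sym2 V → unitInterval) {a b c : V} (hab : a ≠ b) (hac : a ≠ c) :
    (prodBernoulli w).real ((openConn a b)ᶜ ∩ (openConn a c)ᶜ ∩ (openConn b c)ᶜ) *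
        (prodBernoulli w).real {ω : BondConfig V | ω ∈ openConn a b ∧ ω ∈ openConn a c ∧ {e | e ∈ ω ∧ a ∉ e} ∉ openConn b c} ≤
      (prodBernoulli w).real (openConn a c ∩ (openConn a b)ᶜ) * (prodBernoulli w).real (openConn a b ∩ (openConn a c)ᶜ) := by
  obtain ⟨_instV⟩ := nonempty_fintype V
  have hp0 : ∀ e, 0 ≤ (w e : ℝ) := fun e => (w e).2.1
  have hp1 : ∀ e, (w e : ℝ) ≤ 1 := fun e => (w e).2.2
  have key := bhkRow_PrW (p := fun e => (w e : ℝ)) hp0 hp1 Finset.univ hab hac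
  have hco : ∀ (S : Finset (Sym2 V)) (u v : V),
      (↑S : Set (Sym2 V)) ∈ openConn u v ↔ (openGraph (↑S : Set (Sym2 V))).Reachable u v := fun _ _ _ => Iff.rfl
  have hcoe : ∀ S : Finset (Sym2 V), (↑(S \ touch {a}) : Set (Sym2 V)) = {e | e ∈ (↑S : Set (Sym2 V)) ∧ a ∉ e} := by
    intro S; ext e
    simp only [Finset.coe_sdiff, Set.mem_sdiff, Finset.mem_coe, mem_touch, Finset.mem_singleton, exists_eq_left, Set.mem_setOf_eq]
  have e2 : (prodBernoulli w).real ((openConn a b)ᶜ ∩ (openConn a c)ᶜ ∩ (openConn b c)ᶜ) =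
      PrW Finset.univ (fun e => (w e : ℝ)) ((conn a b)ᶜ ∩ (conn a c)ᶜ ∩ (conn b c)ᶜ) :=
    prodBernoulli_real_eq_PrW_univ w fun S => by simp only [Set.mem_inter_iff, Set.mem_compl_iff, mem_conn, hco]
  have e3 : (prodBernoulli w).real (openConn a b ∩ (openConn a c)ᶜ) = PrW Finset.univ (fun e => (w e : ℝ)) (conn a b ∩ (conn a c)ᶜ) :=
    prodBernoulli_real_eq_PrW_univ w fun S => by simp only [Set.mem_inter_iff, Set.mem_compl_iff, mem_conn, hco]
  have e4 : (prodBernoulli w).real (openConn a c ∩ (openConn a b)ᶜ) = PrW Finset.univ (fun e => (w e : ℝ)) (conn a c ∩ (conn a b)ᶜ) :=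
    prodBernoulli_real_eq_PrW_univ w fun S => by simp only [Set.mem_inter_iff, Set.mem_compl_iff, mem_conn, hco]
  have e6 : (prodBernoulli w).real {ω : BondConfig V | ω ∈ openConn a b ∧ ω ∈ openConn a c ∧ {e | e ∈ ω ∧ a ∉ e} ∉ openConn b c} =
      PrW Finset.univ (fun e => (w e : ℝ)) (conn a b ∩ conn a c ∩ pivEv a b c) :=
    prodBernoulli_real_eq_PrW_univ w fun S => by
      simp only [Set.mem_inter_iff, mem_conn, mem_pivEv, mem_cl, Set.mem_setOf_eq, hco, ← hcoe, and_assoc]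
  rw [e2, e3, e4, e6]
  exact key

end PivotalBHK

end Summit.CriticalPhenomena.PercolationContinuityZ3.Theorems

end
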